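import Literature.NumberTheory.GaloisCohomology.Howard2004.ResidualTateDualBijectiveProofs
import Literature.NumberTheory.GaloisCohomology.Howard2004.ResidualSelfOrthogonalProofs
import Literature.NumberTheory.GaloisCohomology.Howard2004.RelaxedSelmerLagrangianCountProofs
import Literature.NumberTheory.GaloisCohomology.Howard2004.TransverseIsotropyProofs
import Literature.NumberTheory.GaloisCohomology.Howard2004.DVRSettingLevelTrivialityProofs
import Literature.NumberTheory.GaloisCohomology.Howard2004.DVRSettingEngineLocalInputsProofs
import Literature.NumberTheory.GaloisCohomology.Howard2004.ResidualSelmerEigenpartsProofs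
import Literature.NumberTheory.GaloisCohomology.Howard2004.RingClassConjugationStableProofs
import Literature.NumberTheory.GaloisCohomology.Howard2004.InertLocalPairingSymmetricProofs
import Literature.NumberTheory.GaloisCohomology.Howard2004.InertTransverseDecompositionOfUnitsProofs
import Literature.NumberTheory.GaloisCohomology.Howard2004.DVRSettingResidualLocalInputsProofs
import HarnessLib

/-!
# Howard 2004, Lemma 1.5.3 on a `DVRSetting`: the local-pairing letters `hnd`, `hf`, `ht` at the RESIDUAL level `T̄`
# (proofs file, (GD-LINE-S) R5 part 1 — RES-ND + the isotropy of `H¹_f`, `H¹_tr`)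

Topic `NumberTheory/GaloisCohomology/Howard2004`.  THEOREMS ONLY: no definition, no named fact, no instance, no
notation, no `sorry`.

B. Howard, *The Heegner point Kolyvagin system*, Compositio Math. **140** (2004) = arXiv:1202.6340, Lemma 1.5.3 and its
proof (arXiv Lemma 2.5.3, p. 10 L10–40): at a degree-two prime `q` the local pairing
`⟨ , ⟩_q : H¹(K_q, T̄) × H¹(K_q̄, T̄) → R̄` of H.4 (read through `θ`, H.5) is `G_ℚ`-invariant and perfect, and `H¹_f`,
`H¹_tr` are each maximal isotropic (Prop. 1.1.9 + H.4).  The cell's kernel forms of the (GD-line) count and of (DICH),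
`DualityDatum.length_map_inf_eigen_eq_one` (`EigenSelmerLineCountProofs`) and
`DualityDatum.map_inf_le_or_le_of_isotropic_of_eigen` (`EigenSelmerDichotomyProofs`), take these facts as the binders
`hnd`, `hf`, `ht` (and `horth`, `hiso`: sequel `ResidualOrthogonalityIsotropyProofs`) over an ARBITRARY residual datum.
THIS FILE proves them on a `DVRSetting S` with H.0–H.5 (`hy`), at level `k`, for ANY
`Dbar : DualityDatum p S.cd S.ρbar (Rk k)` (with the clause `hDbar` (`D̄.e (π̄ s) (π̄ t) = π^{e_k-1} e_k(s,t)`) of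
`DVRSetting.exists_residualDualityDatum` only where used), at a finite place `q` with `h : S.cd.σ • q = q`, in the cast
currency `(h.symm ▸ ·)` of those files, with `Lf := F̄_k(q)` (`F̄_k := (hy.h1 k).1.propagateStructure (S.t k).cond`),
`Lt := transverseStructure p S.ρbar S.jbar (Sum.inr q)`, and a Frobenius readout `(exp, lam, Θ̄)` as in
`ResidualTateDualBijectiveProofs` (`exists_residual_toTateDual_bijective`) at a level `p^{k'} ∈ 𝔪^{e_k}` together with a
family of local invariant maps `inv : LocalInvariants K (p^{k'})` — all PARAMETERS (the assembler instantiates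
`k' := e_k`, `exp := log⁻¹`):

* §0 small residual letters: `p^{k'}·T̄ = 0` for `p^{k'} ∈ 𝔪^{e_k}`, trivial action of `Γ_{K_q}` / `Γ_{K_{σ q}}` on `T̄` at a
  single `q ∈ levelPrimes k` (LEAD's `toLocal_ρbar_apply_eq_self_of_subset_levelPrimes`); `T̄` `p`-primary and
  `(ℓ+1)·T̄ = 0` are x9-p1-w3's `exists_pow_p_smul_residual_eq_zero` / `residueChar_succ_smul_residual_eq_zero_of_mem_levelPrimes`
  (`DVRSettingResidualLocalInputsProofs`, imported — not restated).
* §1 `residual_hnd` — `⟨ , ⟩_q` is left non-degenerate (`RelaxedSelmerLagrangianCountProofs` (hnd) at `(T̄, D̄)`: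
  `Θ̄` bijective + `inv.IsPerfect`).
* §2 `residual_hf` — `Lf = F̄_k(q)` is isotropic (the «→» half of R2's `isSelfOrthogonal_residualStructure` at `q`);
  `residual_ht` — `Lt = H¹_tr(K_q, T̄)` is isotropic (`TransverseIsotropyProofs` at `T̄`, NO `d_K` / unit hypothesis:
  `σ₀`/`hcyc` from `exists_forall_pow_inv_mul_mem_localRingClassSubgroup_of_isDegreeTwo'`,
  `hφ := ConjugationDatum.φ_mem_localRingClassSubgroup`).

Cell `pub/bsd-print-x9`, G87 = Howard Thm. 1.6.1 (print leaf `stub_h161` of stmt-BirchSwinnertonDyer-22642); seat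
`bsd-line-x10b-p2` g15, brick (GD-LINE-S) part R5 (RES-ORTH/ND/ISO) of x10b-p1-w8 g11's split; consumer: R7
(`DVRSettingEngineGDLineProofs`, letters `hnd`, `ht`).  HONEST FRAMING: `thm161_dvrKolyvaginBound` is NOT proved here;
no summit statement is proved; the Birch–Swinnerton-Dyer conjecture is not proved by any of this.

References: [Howard2004HeegnerKolyvagin] Lemma 1.5.3, Prop. 1.1.9, §1.3 H.4/H.5; [MilneADT2006] I Cor. 2.3;
[NeukirchSchmidtWingberg2008] I §4 (1.4.4).
-/

set_option autoImplicit false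

noncomputable section

open Function NumberField IsDedekindDomain Field CategoryTheory
open scoped NumberField ContRepresentation

namespace Literature.NumberTheory.GaloisCohomology.Howard2004

open Literature.NumberTheory.GaloisRepresentations
open Literature.NumberTheory.GaloisRepresentations.DiscreteGaloisModule
open Literature.RingTheory.CompleteLocalRings

namespace DVRSetting

variable {p : ℕ} [Fact p.Prime] {K : Type} [Field K] [NumberField K]
  {R : Type} [CommRing R] [IsDomain R] [IsDiscreteValuationRing R] [Algebra ℤ_[p] R]
  {N : ℕ → Type} [∀ k, AddCommGroup (N k)] [∀ k, TopologicalSpace (N k)]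
  [∀ k, DiscreteTopology (N k)] [∀ k, Module R (N k)]
  {Rk : ℕ → Type} [∀ k, CommRing (Rk k)] [∀ k, IsLocalRing (Rk k)] [∀ k, TopologicalSpace (Rk k)]
  [∀ k, DiscreteTopology (Rk k)] [∀ k, Algebra ℤ_[p] (Rk k)] [∀ k, Algebra R (Rk k)]
  [∀ k, Module (Rk k) (N k)] [∀ k, IsScalarTower R (Rk k) (N k)]
  {Nbar : Type} [AddCommGroup Nbar] [TopologicalSpace Nbar] [DiscreteTopology Nbar]
  [∀ k, Module (Rk k) Nbar]
  {Nq : ℕ → Finset (HeightOneSpectrum (𝓞 K)) → Type} [∀ k n, AddCommGroup (Nq k n)]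
  [∀ k n, TopologicalSpace (Nq k n)] [∀ k n, DiscreteTopology (Nq k n)]
  [∀ k n, Module (Rk k) (Nq k n)] [∀ k n, Module R (Nq k n)]
  [∀ k n, IsScalarTower R (Rk k) (Nq k n)]

/-! ## §0 Small residual letters -/

/-- `p^{k'} · T̄ = 0` for `p^{k'} ∈ 𝔪^{e_k}` (`T̄` is an `R_k`-module and `p^{k'} R_k = 0`).
[cite: Howard2004HeegnerKolyvagin, §1.3 H.1 and §1.6 (arXiv:1202.6340 p. 7 L59, p. 11 L33–34)] -/
theorem pow_natCast_nsmul_residual_eq_zero (S : DVRSetting p K R N Rk Nbar Nq) (hy : S.SatisfiesH) (k : ℕ)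
    {k' : ℕ} (hk' : ((p : ℕ) : R) ^ k' ∈ IsLocalRing.maximalIdeal R ^ S.e k) (m : Nbar) :
    (p ^ k') • m = 0 := by
  have h := S.natCast_pow_smul_levelRing_eq_zero hy k hk' (1 : Rk k)
  rw [← Nat.cast_smul_eq_nsmul (Rk k), ← mul_one ((p ^ k' : ℕ) : Rk k), ← smul_eq_mul,
    Nat.cast_smul_eq_nsmul, h, zero_smul]

/-- Trivial action of `Γ_{K_{σ q}}` on `T̄` at `q ∈ levelPrimes k` with `σ q = q` (the `htriv'` letter).
[cite: Howard2004HeegnerKolyvagin, Def. 1.2.1 and §1.3 (arXiv:1202.6340 p. 6 L60–68, p. 7 L44–48)] -/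
theorem toLocal_sigma_smul_ρbar_apply_eq_self (S : DVRSetting p K R N Rk Nbar Nq) (hy : S.SatisfiesH) (k : ℕ)
    {q : HeightOneSpectrum (𝓞 K)} (hq : q ∈ S.levelPrimes k) (h : S.cd.σ • q = q)
    (g : absoluteGaloisGroup ((S.cd.σ • q).adicCompletion K)) (x : Nbar) :
    GaloisRep.toLocal (S.cd.σ • q) S.ρbar g x = x := by
  have hsub : (↑({q} : Finset (HeightOneSpectrum (𝓞 K))) : Set (HeightOneSpectrum (𝓞 K))) ⊆ S.levelPrimes k := by
    rw [Finset.coe_singleton, Set.singleton_subset_iff]; exact hq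
  have hmem : S.cd.σ • q ∈ ({q} : Finset (HeightOneSpectrum (𝓞 K))) := by
    rw [h]; exact Finset.mem_singleton_self q
  exact S.toLocal_ρbar_apply_eq_self_of_subset_levelPrimes hy hsub hmem g x

/-- Trivial action of `Γ_{K_q}` on `T̄` at `q ∈ levelPrimes k` (the `htriv` letter, LEAD's
`toLocal_ρbar_apply_eq_self_of_subset_levelPrimes` at `n = {q}`).
[cite: Howard2004HeegnerKolyvagin, Def. 1.2.1 and H.1 (arXiv:1202.6340 p. 6 L60–68, p. 7 L59)] -/
theorem toLocal_ρbar_apply_eq_self_of_mem_levelPrimes (S : DVRSetting p K R N Rk Nbar Nq) (hy : S.SatisfiesH)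
    (k : ℕ) {q : HeightOneSpectrum (𝓞 K)} (hq : q ∈ S.levelPrimes k)
    (g : absoluteGaloisGroup (q.adicCompletion K)) (x : Nbar) :
    GaloisRep.toLocal q S.ρbar g x = x := by
  have hsub : (↑({q} : Finset (HeightOneSpectrum (𝓞 K))) : Set (HeightOneSpectrum (𝓞 K))) ⊆ S.levelPrimes k := by
    rw [Finset.coe_singleton, Set.singleton_subset_iff]; exact hq
  exact S.toLocal_ρbar_apply_eq_self_of_subset_levelPrimes hy hsub (Finset.mem_singleton_self q) g x

/-! ## §1 (hnd): `⟨ , ⟩_q` is left non-degenerate on `H¹(K_q, T̄)` -/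

/-- **(hnd) at the residual level.**  For any residual datum `Dbar` on `T̄` over `R_k`, a readout `(exp, lam)` at a level
`p^{k'} ∈ 𝔪^{e_k}` with `Θ̄ = Dbar.toTateDual lam hlam exp hexp` bijective (`exists_residual_toTateDual_bijective`) and
a family `inv` of local invariant maps with `inv.IsPerfect` (local Tate duality), at a finite place `q` with
`σ q = q`: if `⟨u, transport_q y⟩_q = 0` for all `y ∈ H¹(K_q, T̄)` then `u = 0` — VERBATIM the binder `hnd` of
`DualityDatum.length_map_inf_eigen_eq_one` / `map_inf_le_or_le_of_isotropic_of_eigen` at `(S.ρbar, Dbar)`.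
[cite: Howard2004HeegnerKolyvagin, Lemma 1.5.3 (arXiv:1202.6340 p. 10 L10–12: «perfect … local Tate pairing») and §1.3 H.4 (p. 7 L78–82)] [cite: MilneADT2006, Ch. I Cor. 2.3] -/
theorem residual_hnd [Finite Nbar] (S : DVRSetting p K R N Rk Nbar Nq) (hy : S.SatisfiesH) (k : ℕ) {k' : ℕ}
    (hk' : ((p : ℕ) : R) ^ k' ∈ IsLocalRing.maximalIdeal R ^ S.e k)
    (exp : ZMod (p ^ k') →+ MuCarrier K (p ^ k'))
    (hexp : ∀ (g : absoluteGaloisGroup K) (x : ZMod (p ^ k')),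
      exp (cyclotomicCharacterModPow K p k' g * x) = mu K (p ^ k') g (exp x))
    (Dbar : DualityDatum p S.cd S.ρbar (Rk k)) (lam : Rk k →+ ZMod (p ^ k'))
    (hlam : ∀ (z : ℤ_[p]) (a : Rk k), lam (algebraMap ℤ_[p] (Rk k) z * a) = PadicInt.toZModPow k' z * lam a)
    (hΘ : Bijective (Dbar.toTateDual lam hlam exp hexp))
    (inv : LocalInvariants K (p ^ k')) (hperf : inv.IsPerfect)
    {q : HeightOneSpectrum (𝓞 K)} (h : S.cd.σ • q = q) :
    ∀ u : galoisCohomology (S.ρbar.toLocal (Sum.inr q)) 1,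
      (∀ y, Dbar.localCup (Sum.inr q) u (S.cd.transportH1 S.ρbar q
        (h.symm ▸ y : galoisCohomology (S.ρbar.toLocal (Sum.inr (S.cd.σ • q))) 1)) = 0) → u = 0 := by
  intro u hu
  exact Dbar.eq_zero_of_forall_localCup_transportH1_cast_eq_zero lam hlam exp hexp
    (S.pow_natCast_nsmul_residual_eq_zero hy k hk') hΘ inv hperf h u hu

/-! ## §2 (hf), (ht): `H¹_f` and `H¹_tr` are isotropic -/

/-- Casting a local class along `v = w` preserves membership in a Selmer structure's local conditions.
[cite: Howard2004HeegnerKolyvagin, §1.3 (arXiv:1202.6340 p. 7 L44–48: «`v̄ = v^τ`» at a degree-two prime)] -/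
theorem cast_mem_selmerStructure_iff {M : Type} [AddCommGroup M] [TopologicalSpace M] [DiscreteTopology M]
    {ρ : DiscreteGaloisModule K M} (𝓕 : SelmerStructure ρ) {v w : HeightOneSpectrum (𝓞 K)} (e : v = w)
    (x : galoisCohomology (ρ.toLocal (Sum.inr v)) 1) :
    (e ▸ x : galoisCohomology (ρ.toLocal (Sum.inr w)) 1) ∈ 𝓕 (Sum.inr w) ↔ x ∈ 𝓕 (Sum.inr v) := by
  subst e
  exact Iff.rfl

/-- **(hf) at the residual level: `Lf = F̄_k(q)` is isotropic for `⟨ , ⟩_q`** — the «→» half of H.4 for the residual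
triple at `q` (R2: `isSelfOrthogonal_residualStructure`), read in the cast currency at an inert `q`.
[cite: Howard2004HeegnerKolyvagin, §1.3 H.4 and Remark 1.3.1 (arXiv:1202.6340 p. 7 L69–82, L125–127), Lemma 1.5.3 (p. 10 L34–36)] -/
theorem residual_hf (S : DVRSetting p K R N Rk Nbar Nq) (hy : S.SatisfiesH) (k : ℕ)
    (Dbar : DualityDatum p S.cd S.ρbar (Rk k))
    (hDbar : ∀ s t : N k, Dbar.e (S.πbar k s) (S.πbar k t) =
      algebraMap R (Rk k) S.π ^ (S.e k - 1) * (S.D k).e s t)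
    {q : HeightOneSpectrum (𝓞 K)} (h : S.cd.σ • q = q) :
    ∀ u ∈ ((hy.h1 k).1.propagateStructure (S.t k).cond) (Sum.inr q),
      ∀ u' ∈ ((hy.h1 k).1.propagateStructure (S.t k).cond) (Sum.inr q),
        Dbar.localCup (Sum.inr q) u (S.cd.transportH1 S.ρbar q
          (h.symm ▸ u' : galoisCohomology (S.ρbar.toLocal (Sum.inr (S.cd.σ • q))) 1)) = 0 := by
  intro u hu u' hu'
  have hso := S.isSelfOrthogonal_residualStructure hy k Dbar hDbar q
  exact ((hso.1 u).1 hu) _ ⟨_, (cast_mem_selmerStructure_iff _ h.symm u').2 hu', rfl⟩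

/-- **(ht) at the residual level: `Lt = H¹_tr(K_q, T̄)` is isotropic for `⟨ , ⟩_q`** at a prime `q ∈ levelPrimes k`
(so `Γ_{K_q}` acts trivially on `T̄` and `σ q = q`), for ANY residual datum — `TransverseIsotropyProofs` at `T̄`: the
transverse classes are inflated from the cyclic quotient `Gal(K[q]_𝔔/K_q)` of order `ℓ + 1`, prime to `p`.
[cite: Howard2004HeegnerKolyvagin, §1.3 H.4 (arXiv:1202.6340 p. 7 L78–82) and Lemma 1.5.6 (p. 10 L86–88)] [cite: NeukirchSchmidtWingberg2008, I §4 (1.4.4)] -/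
theorem residual_ht (S : DVRSetting p K R N Rk Nbar Nq) (hy : S.SatisfiesH) (k : ℕ)
    (Dbar : DualityDatum p S.cd S.ρbar (Rk k)) {q : HeightOneSpectrum (𝓞 K)} (hq : q ∈ S.levelPrimes k)
    (h : S.cd.σ • q = q) :
    ∀ v ∈ transverseStructure p S.ρbar S.jbar (Sum.inr q), ∀ v' ∈ transverseStructure p S.ρbar S.jbar (Sum.inr q),
      Dbar.localCup (Sum.inr q) v (S.cd.transportH1 S.ρbar q
        (h.symm ▸ v' : galoisCohomology (S.ρbar.toLocal (Sum.inr (S.cd.σ • q))) 1)) = 0 := by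
  haveI : Finite (Rk k) := S.finite_coeffLevel hy k
  have hp : p.Prime := Fact.out
  intro v hv v' hv'
  have hqL : q ∈ S.L := hq.1
  have h𝒯q : transverseStructure p S.ρbar S.jbar (Sum.inr q) =
      transverseCondition p S.ρbar (residueChar q) S.jbar q := by
    rw [transverseStructure_inr]; rfl
  rw [h𝒯q] at hv hv'
  have hv'' : (h.symm ▸ v' : galoisCohomology (S.ρbar.toLocal (Sum.inr (S.cd.σ • q))) 1) ∈
      transverseCondition p S.ρbar (residueChar q) S.jbar (S.cd.σ • q) :=
    (cast_mem_transverseCondition_iff S.ρbar p (residueChar q) S.jbar h.symm v').2 hv'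
  -- odd torsion of `R_k`: `p^{e_k} R_k = 0`
  have hRk : ∀ r : Rk k, p ^ S.e k • r = 0 :=
    S.natCast_pow_smul_levelRing_eq_zero hy k (S.natCast_pow_mem_maximalIdeal_pow_of_le hy le_rfl)
  have hodd : Odd (p ^ S.e k) := (hp.odd_of_ne_two hy.p_odd).pow
  obtain ⟨σ₀, -, hcyc⟩ :=
    exists_forall_pow_inv_mul_mem_localRingClassSubgroup_of_isDegreeTwo' hy.imagQuad S.jbar (S.isDegreeTwo_of_mem_L hy hqL)
  have hℓ0 : residueChar q ≠ 0 := (prime_residueChar q).ne_zero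
  exact Dbar.localCup_transportH1_eq_zero_of_mem_transverseCondition (residueChar q) S.jbar q
    (S.toLocal_ρbar_apply_eq_self_of_mem_levelPrimes hy k hq) (S.toLocal_sigma_smul_ρbar_apply_eq_self hy k hq h)
    (S.cd.toLocal_twist_apply_eq_self S.ρbar q (S.toLocal_sigma_smul_ρbar_apply_eq_self hy k hq h))
    (S.exists_pow_p_smul_residual_eq_zero hy) hodd hRk σ₀ hcyc
    (fun g hg => S.cd.φ_mem_localRingClassSubgroup hy.imagQuad S.jbar hℓ0 q hg) hv hv''

end DVRSetting

end Literature.NumberTheory.GaloisCohomology.Howard2004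

end
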